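import Literature.NumberTheory.Sieve.BombieriFriedlanderIwaniecTheorem9
import HarnessLib

/-!
# Bombieri–Friedlander–Iwaniec 1986, Theorem 6: the case `Q²R ≤ x` proved in §13; the form used in §16

Topic `Literature/NumberTheory/Sieve`.  Companion to
`Literature.NumberTheory.Sieve.BombieriFriedlanderIwaniecTheorem9`, which vendors **Theorem 6** of
E. Bombieri, J. B. Friedlander, H. Iwaniec, *Primes in arithmetic progressions to large moduli*,
Acta Math. 156 (1986), 203–251 (§13, p. 244) as the named fact
`Literature.NumberTheory.Sieve.BombieriFriedlanderIwaniecTheorem6`, literally as printed: conclusion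
(3.2) for the dispersion sum `𝒟(M,N,Q,R)` with the weights (A₇) (`γ_q = 1` for `Q < q ≤ Q₁`,
`QR < xℒ^{−B}`), for ALL coefficient sequences satisfying (A₁)–(A₄) and ALL `Q ≥ 1/2`.  This file
records, as the conclusion of the (trivial) theorem `BombieriFriedlanderIwaniecTheorem6.core`, the
statement that the printed proof actually establishes — Theorem 6 under the proof's standing
assumption (13.1) `Q²R ≤ x` — together with the audit below, and, as the conclusion of the equally
trivial `BombieriFriedlanderIwaniecTheorem6.intervalForm`, Theorem 6 for all `Q` as printed but for
coefficients `β` satisfying (A₂) on every sub-interval of `n ∼ N` (the class §16 applies it to, and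
the class for which the reduction of p. 241 goes through; see the Addendum).  Both are PROVED (from
the named fact) and the file introduces no definition and no named fact (D-0026: a proving seat may
not mint facts; an operator or planner may promote either conclusion verbatim to a named fact if a
route wants it).

## Faithfulness audit of the source's proof (pp. 241–244): what §13 proves

The printed proof of Theorem 6 establishes (3.2) under the standing assumption
**(13.1) `Q²R ≤ x`**, which p. 241 introduces "without loss of generality": for `Q²R > x` one is to
switch the rôles of `q` and of the complementary divisor `s = (mn − a)/(qr) ∼ S = x/QR` (so that
`S²R ≤ x`, and `S > ℒ^B` by (A₇)), and "since `s` runs through an interval dependent on `m, n, r`",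
to "remove this dependence" "by a subdivision argument" "with an admissible error term" (p. 242).
That reduction does not go through for the abstract class of coefficients (A₁)–(A₄) over which the
theorem is stated:

* the condition `Q < (mn − a)/(rs) ≤ Q₁` couples `n` with the new modulus variable `s` as soon as
  `m` and `r` are localised, so any subdivision making the `s`-range independent of `(m, n, r)`
  localises `n` to short intervals `J ⊂ (N, 2N]` (a smooth or Mellin separation instead twists
  `β_n` by `n^{it}`, to the same effect), and the case (13.1) is then applied to dispersion sums
  whose coefficients are the restrictions `β·1_J`;
* the case (13.1) USES hypothesis (A₂) for its `β` — exactly once, in §7 ((7.2)–(7.4): Theorem 0 (a)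
  applied to `β` for the moduli `k ≤ 2Q₀R`, i.e. (A₂) for the small moduli `k ≤ ℒ^{B₁}` and all
  twists `d`) — hence, for the pieces, (A₂) for `β·1_J`;
* (A₂) for `β` on `n ∼ N` (p. 206) does NOT imply (A₂) for `β·1_J`: e.g. `β` = the indicator of the
  integers free of prime factors `≤ ℒ^{B₀}` that are `≡ 1 (mod 4)` in `(N, 3N/2]` or `≡ 3 (mod 4)` in
  `(3N/2, 2N]` satisfies (A₂) and (A₄) on `n ∼ N` (it is balanced in every reduced class to every
  modulus, with power-saving sieve errors) but is not equidistributed `mod 4` on `J = (N, 3N/2]`;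
* moreover for general `a` the switch exchanges the built-in coprimality `(qr, a) = 1` of (3.1) for
  `(sr, a) = 1`, and the subtracted means `φ(qr)⁻¹ ∑_{(mn,qr)=1}` and `φ(sr)⁻¹ ∑_{(mn,sr)=1}` are not
  exchanged by the symmetry (they agree only asymptotically, through `∑ 1/φ` over `s`-intervals of
  length `≍ S ≥ ℒ^B` — "this lower bound being crucial to the argument", p. 242), so the printed
  five lines are a sketch whose completion needs more than (A₁)–(A₄) as stated.

In the source's own application (§16, proof of Theorem 9) `β` is an explicit box-restricted
convolution of `μ`, `1`, `log` (Heath-Brown's identity, §15), for which (A₂) holds on every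
sub-interval by the Siegel–Walfisz theorem, and the later literature performs the `q ↔ s` switch for
the explicit sequence (Fouvry's treatment of the Titchmarsh divisor problem by Dirichlet's hyperbola
method; S. Drappeau, Proc. LMS 114 (2017), remark after Thm 6.2, whose Thm 5.1 is the analogue of the
case (13.1): `Q ≤ x^{1/2+δ}`, `x^η ≤ N ≤ Q^{2/3−η}`).  So Theorem 9 is not affected; but what §13
proves about the abstract class (A₁)–(A₄), (A₇) is the case (13.1): the statement of
`BombieriFriedlanderIwaniecTheorem6` with the single extra hypothesis `Q ^ 2 * R ≤ x` (the conclusion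
of `BombieriFriedlanderIwaniecTheorem6.core` below).  Under it and `R < N x^{−ε} < x^{1/4}` the level
condition `QR < xℒ^{−B₇}` of (A₇) is implied for large `x`; it is kept so that the two statements
have the same shape.  Whether the general statement is true is not decided here (no counterexample
is claimed; to leading order the main terms of the `mod 4` example above do match).

A second point bears on any future proof of the core case, not on its statement: in (13.2) Lemma 1
(= Deshouillers–Iwaniec, Invent. Math. 70 (1982), Thm 12) is applied to the weights
`g(c,d) = γ̃(q₀δ₂c) γ̃(q₀δ₁d) f(ξq₀δ₁δ₂cd)`, a family indexed by `ξ`, by `Q₁/Q ∈ (1,2]` and by the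
smoothing width `Q/Q₀` of `γ̃` (normalised derivatives `≍ Q₀^j = ℒ^{O(j)}`), so the dependence of the
constant of Lemma 1 on `g` has to be polynomial in the derivative bounds (true from the proof of
DI Thm 12; explicit in Drappeau's Thm 2.1); the tree's one-weight hypothesis
`BFI.Lemma1BoundFor BFI.plateau2 (5/4)` (used for Theorems 1, 5, 5*) is not enough here.
Everything else needed for a proof of the core case from Lemma 1 is in the tree and PROVED
(`…DispersionSmoothing` §3, `…DispersionS3` §4, `…DispersionS2` §5, `…DispersionS1`/`…S1Rest` §6 with
`BFI.calX`, `BFI.calR1` = (6.13), (6.14) for general `γ`, `…DispersionMainTerm` §7,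
`BFI.dispG_le_struct` of `…Theorem1Terms`, Lemma 3 = Shiu, Theorem 0 (a)), except the §13-specific
steps: the smoothing of `γ` with its Lemma-3 correction `≪ ‖α‖‖β‖x^{1/2}ℒ^B Q₀^{−1/2}` (p. 243), the
rearrangement (13.2) of `BFI.calR1` into sums `BFI.dispK` (Möbius in the divisors of `a`, the
`ξ`-integral separating `h, r` from `q₁q₂`), the norm bound (13.3) `‖B‖² ≪ x^εR^{−2}H‖β‖⁴` and the
size bound (13.4) `𝓘² ≪ x^ε(Q²N⁴ + Q³N^{5/2})` (which uses `Q ≤ √x`, i.e. (13.1), as does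
`H = x^εQ²R/M ≤ x^εN`), giving `ℛ₁ ≪ x^ε M^{1/2}R^{−1/2}(N² + Q^{1/2}N^{5/4})‖β‖²`, admissible for
(7.6) iff `N³R < x^{1−ε}` and `N^{3/2}QR < x^{1−ε}` (the latter from the former and (13.1)).

## Addendum (second reading, 2026-08-15): is the printed generality false? — and the form §16 uses

* **No counterexample from the example above.**  For `β` = the `mod 4` example (balanced on `(N, 2N]`,
  biased on its halves), `a = 1`, `R = 1/2` (so `r = 1`), `γ = 1_{(Q,2Q]}` with `Q² > x`, and the
  adversarial `α_m = χ₄(m)`, write `mn − 1 = qs`: the congruence part of `𝒟` becomes a sum over the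
  complementary divisor `s ≍ S = x/Q` of counts of `β` in the windows `n ∈ (Qs/m, 2Qs/m]` in the
  class `n ≡ m̄ (mod s)`, and for `4 ∣ s` each window IS biased (by `≍ N/(φ(s)ℒ)`, with the sign of
  `χ₄(m)`).  But `s` runs over ALL integers of its range with both ends of the range cut only by the
  window leaving `(N, 2N]`, and `∑_s φ(s)⁻¹ F(s)` over such a complete range integrates `F` against
  `ds/s`; by Fubini `∫ 1_{uN < n ≤ λuN} du/u = log λ` for every `n`, so the `s`-sum re-weights every
  `n ∈ (N, 2N]` equally and the total bias is `(log λ)·[#supp β ∩ (N, 3N/2] − #supp β ∩ (3N/2, 2N]]`,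
  which vanishes (to the accuracy of (A₂)) because `β` is balanced on the whole dyadic interval.
  What is left is the discretisation error of the `s`-sum, `O(x ℒ^{O(1)}/S) = O(x ℒ^{O(1)−B₇})`,
  admissible since the level exponent `B₇` of (A₇) is at our disposal — the same mechanism as
  "`S > ℒ^B`, this lower bound being crucial" (p. 242).  So the leading-order obstruction to the
  printed generality cancels; the general statement is plausibly TRUE, but a proof would have to
  keep the `n`-sum over `(N, 2N]` whole (e.g. switch `q ↔ s` inside the dispersion and carry out the
  complete `s`-summation in the main terms before invoking (A₂)), and no such argument is in print.
  Nothing here is claimed as a theorem; it is recorded so that the named fact is not mistaken for a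
  refuted one.
* **The form the source USES (§16) and its printed argument supports.**  In the proof of Theorem 9
  (§16, p. 250) Theorem 6 is applied with moduli `qr`, `QR < xℒ^{−B}`, `R < x^{1/10}`, so `Q²R > x`
  throughout the upper range: the case (13.1) alone (`…Theorem6.core`) does NOT reach Theorem 9.
  There `β` is a convolution of box-restricted variables from Heath-Brown's identity (a "partial
  sum" of (15.6), p. 250), which satisfies (A₂) on every sub-interval of `(N, 2N]` as well (Perron
  separation of the cut and the Siegel–Walfisz theorem for `μ(n)n^{it}`, `|t| ≤ ℒ^{O(1)}`; intervals
  shorter than `Nℒ^{−2A}` trivially), and for that class the p. 241 reduction to (13.1) does go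
  through once written out (subdivision of `s, m, n, r`
  with Lemma 3 on the boundary boxes; bookkeeping of the coprimality with `a`; matching of the
  subtracted means through `∑_s 1/φ(rs)` over `s`-intervals of length `≍ S ≥ ℒ^B`) — this is also how
  the later literature reaches `q ≤ x^{1−ε}` for explicit sequences (Drappeau, loc. cit. below,
  remark after Thm 6.2, by "the Dirichlet hyperbola method", referring to §VII of Fouvry's Titchmarsh
  divisor paper, J. reine angew. Math. 357 (1985)).  That statement — Theorem 6 verbatim, all `Q`,
  with (A₂) required of every interval restriction `β·1_{(N₁,N₂]}` (the device of
  `BombieriFriedlanderIwaniecTheorem5StarInterval` for `α`) — is the conclusion of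
  `BombieriFriedlanderIwaniecTheorem6.intervalForm` below.  If the named fact is ever restated "as
  proved", the interval form is the restatement that keeps Theorem 9 derivable; the core (13.1) form
  is its abstract heart (from Lemma 1 uniformly in the weight, as said above).

## Contents

* `BombieriFriedlanderIwaniecTheorem6.core` (PROVED, one line from the named fact): Theorem 6 in the
  case (13.1), spelled out in full as the conclusion.
* `BFI.SiegelWalfiszHyp.congr`, `BFI.SiegelWalfiszHyp.of_interval` (PROVED): (A₂) sees `β` only on
  `n ∼ N`; (A₂) for every interval restriction of `β` gives (A₂) for `β` (the interval `(N, 2N]`).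
* `BombieriFriedlanderIwaniecTheorem6.intervalForm` (PROVED, from the named fact): Theorem 6 for all
  `Q` as printed, for `β` with (A₂) on every sub-interval of `(N, 2N]`, spelled out in full.

## References

* E. Bombieri, J. B. Friedlander, H. Iwaniec, *Primes in arithmetic progressions to large moduli*,
  Acta Math. 156 (1986), 203–251: §1 (A₂) p. 206; §3 (3.1)–(3.2) p. 214; §7 (7.2)–(7.4) p. 222;
  §13 (A₇), (13.1) p. 241–242, (13.2)–(13.4) and Theorem 6 pp. 243–244; §16 p. 250.
  [BombieriFriedlanderIwaniecActa1986]
* S. Drappeau, *Sums of Kloosterman sums in arithmetic progressions, and the error term in the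
  dispersion method*, Proc. Lond. Math. Soc. (3) 114 (2017), 684–732 (arXiv:1504.05549), Thm 2.1,
  Thm 5.1, Prop 5.3, remark after Thm 6.2 (context only; nothing of it is vendored here).
-/

open Finset Real
open scoped ArithmeticFunction.sigma

namespace Literature.NumberTheory.Sieve

open BFI

/-- **Bombieri–Friedlander–Iwaniec 1986, Theorem 6 in the case (13.1) `Q²R ≤ x`** — the case proved
on pp. 241–244 of the source (§13: "Without loss of generality we may assume that `Q²R ≤ x` (13.1)";
p. 244: "Summarizing this section we have THEOREM 6. Let (A₁)–(A₄) and (A₇) hold. Let `a ≠ 0` and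
`ε > 0`. We then have (3.2) provided `x^ε R < N < x^{−ε}(x/R)^{1/3}`"), spelled out with the
quantifier structure and objects of `BombieriFriedlanderIwaniecTheorem6` (`BFI.dispD`,
`BFI.a7Weight`, `BFI.SiegelWalfiszHyp`, `BFI.IsSifted`, `BFI.l2Sq`) and the one additional
hypothesis `Q ^ 2 * R ≤ x`: for `a ≠ 0`, `ε > 0`, `A > 0`, `B ≥ 0`, Siegel–Walfisz constants `Csw`,
there are `B₀, B₇, C, x₀` such that for `x ≥ x₀`, `MN = x`, `x^ε ≤ N ≤ x^{1−ε}`, `Q, R ≥ 1/2`,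
`Q < Q₁ ≤ 2Q`, `QR < xℒ^{−B₇}`, `Q²R ≤ x`, `x^εR < N < x^{−ε}(x/R)^{1/3}`, every `β` with (A₂), (A₄),
every real `α`, and every `δ` with `|δ_r| ≤ τ(r)^B`:
`|𝒟(M,N,Q,R; α, β, 1_{q ≤ Q₁}, δ)| ≤ C ‖α‖ ‖β‖ x^{1/2} ℒ^{−A}`.
Here it is derived (trivially) from the named fact, which states the printed generality; the point
of the declaration is its TYPE — the statement the printed argument proves for the abstract class
(A₁)–(A₄), the reduction of `Q²R > x` to (13.1) on p. 241 requiring (A₂) for the restrictions of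
`β` to sub-intervals (module docstring).
[cite: BombieriFriedlanderIwaniecActa1986, §13 Theorem 6 p. 244 with (13.1) p. 241] -/
theorem BombieriFriedlanderIwaniecTheorem6.core (h : BombieriFriedlanderIwaniecTheorem6) :
    ∀ a : ℤ, a ≠ 0 → ∀ ε : ℝ, 0 < ε → ∀ A : ℝ, 0 < A → ∀ B : ℝ, 0 ≤ B → ∀ Csw : ℝ → ℝ,
    ∃ B₀ B₇ C x₀ : ℝ, ∀ x : ℝ, x₀ ≤ x → ∀ M N Q R Q₁ : ℝ,
      M * N = x → x ^ ε ≤ N → N ≤ x ^ (1 - ε) →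
      1 / 2 ≤ Q → 1 / 2 ≤ R → Q < Q₁ → Q₁ ≤ 2 * Q → Q * R < x / Real.log x ^ B₇ →
      Q ^ 2 * R ≤ x →
      x ^ ε * R < N → N < x ^ (-ε) * (x / R) ^ (1 / 3 : ℝ) →
      ∀ β : ℕ → ℝ, SiegelWalfiszHyp N B Csw β → IsSifted (dyadic N) (Real.log x ^ B₀) β →
      ∀ α δ : ℕ → ℝ, (∀ r, |δ r| ≤ (σ 0 r : ℝ) ^ B) →
        |dispD a M N Q R α β (a7Weight Q₁) δ| ≤
          C * Real.sqrt (l2Sq M α) * Real.sqrt (l2Sq N β) * x ^ (1 / 2 : ℝ) / Real.log x ^ A := by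
  intro a ha ε hε A hA B hB Csw
  obtain ⟨B₀, B₇, C, x₀, hC⟩ := h a ha ε hε A hA B hB Csw
  refine ⟨B₀, B₇, C, x₀, fun x hx M N Q R Q₁ hMN hN1 hN2 hQ hR hQ1 hQ2 hQR _ hRN hNR β hsw hsift
    α δ hδ => ?_⟩
  exact hC x hx M N Q R Q₁ hMN hN1 hN2 hQ hR hQ1 hQ2 hQR hRN hNR β hsw hsift α δ hδ

namespace BFI

/-- Hypothesis (A₂) at scale `N` depends on `β` only through its values on `n ∼ N` (all three sums in
`BFI.SiegelWalfiszHyp`, including `‖β‖`, range over `BFI.dyadic N`). [folklore] -/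
theorem SiegelWalfiszHyp.congr {N B : ℝ} {Csw : ℝ → ℝ} {β β' : ℕ → ℝ}
    (h : ∀ n ∈ dyadic N, β' n = β n) (hβ' : SiegelWalfiszHyp N B Csw β') :
    SiegelWalfiszHyp N B Csw β := by
  have hl2 : l2Sq N β' = l2Sq N β := Finset.sum_congr rfl fun n hn => by rw [h n hn]
  intro A hA d k hd hk l hl
  have h1 : (∑ n ∈ dyadic N, if (n : ZMod k) = (l : ZMod k) ∧ n.Coprime d then β n else 0) =
      ∑ n ∈ dyadic N, if (n : ZMod k) = (l : ZMod k) ∧ n.Coprime d then β' n else 0 :=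
    Finset.sum_congr rfl fun n hn => by rw [h n hn]
  have h2 : (∑ n ∈ dyadic N, if n.Coprime (d * k) then β n else 0) =
      ∑ n ∈ dyadic N, if n.Coprime (d * k) then β' n else 0 :=
    Finset.sum_congr rfl fun n hn => by rw [h n hn]
  rw [h1, h2, ← hl2]
  exact hβ' A hA d k hd hk l hl

/-- If every interval restriction `β·1_{(N₁,N₂]}` of `β` satisfies (A₂) at scale `N ≥ 0` (with the
same `B`, `Csw`), then so does `β`: take `(N₁, N₂] = (N, 2N]`, on which the restriction is `β`
throughout `n ∼ N`. [folklore] -/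
theorem SiegelWalfiszHyp.of_interval {N B : ℝ} (hN : 0 ≤ N) {Csw : ℝ → ℝ} {β : ℕ → ℝ}
    (h : ∀ N₁ N₂ : ℝ,
      SiegelWalfiszHyp N B Csw (fun n => if N₁ < (n : ℝ) ∧ (n : ℝ) ≤ N₂ then β n else 0)) :
    SiegelWalfiszHyp N B Csw β :=
  SiegelWalfiszHyp.congr (β' := fun n => if N < (n : ℝ) ∧ (n : ℝ) ≤ 2 * N then β n else 0)
    (fun _ hn => by rw [if_pos ((mem_dyadic hN).1 hn)]) (h N (2 * N))

end BFI

/-- **Bombieri–Friedlander–Iwaniec 1986, Theorem 6 in the form used in §16: all `Q` as printed,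
coefficients `β` with (A₂) on every sub-interval of `n ∼ N`** (§13, Theorem 6 p. 244, applied in §16,
p. 250, to convolutions of box-restricted variables from Heath-Brown's identity; the reduction
"without loss of generality `Q²R ≤ x`" of p. 241 localises `n` to short intervals and so consumes
(A₂) for the interval restrictions of `β`, see the module docstring).  The statement is that of
`BombieriFriedlanderIwaniecTheorem6` verbatim — for `a ≠ 0`, `ε > 0`, `A > 0`, `B ≥ 0`, Siegel–Walfisz
constants `Csw`, there are `B₀, B₇, C, x₀` such that for `x ≥ x₀`, `MN = x`, `x^ε ≤ N ≤ x^{1−ε}`,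
`Q, R ≥ 1/2`, `Q < Q₁ ≤ 2Q`, `QR < xℒ^{−B₇}`, `x^εR < N < x^{−ε}(x/R)^{1/3}`, every admissible `β`,
every real `α`, every `δ` with `|δ_r| ≤ τ(r)^B`:
`|𝒟(M,N,Q,R; α, β, 1_{q ≤ Q₁}, δ)| ≤ C ‖α‖ ‖β‖ x^{1/2} ℒ^{−A}` — except that "admissible `β`" asks,
besides (A₄) (`BFI.IsSifted`), hypothesis (A₂) (`BFI.SiegelWalfiszHyp N B Csw`) of EVERY interval
restriction `n ↦ 1_{N₁ < n ≤ N₂} β_n` (`N₁, N₂` real), the device by which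
`BombieriFriedlanderIwaniecTheorem5StarInterval` records the applied form of Theorem 5*.  This is a
smaller class of `β` than (A₁)–(A₄) (by `BFI.SiegelWalfiszHyp.of_interval`), so the theorem follows
trivially from the named fact; the point of the declaration is its TYPE — the generality in which the
source uses Theorem 6 and which its printed argument supports, and the restatement that keeps
Theorem 9 within reach should the named fact be restated as proved (the case (13.1),
`BombieriFriedlanderIwaniecTheorem6.core`, does not cover the moduli of Theorem 9).
[cite: BombieriFriedlanderIwaniecActa1986, §13 Theorem 6 p. 244; §16 p. 250; (A₂) p. 206] -/
theorem BombieriFriedlanderIwaniecTheorem6.intervalForm (h : BombieriFriedlanderIwaniecTheorem6) :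
    ∀ a : ℤ, a ≠ 0 → ∀ ε : ℝ, 0 < ε → ∀ A : ℝ, 0 < A → ∀ B : ℝ, 0 ≤ B → ∀ Csw : ℝ → ℝ,
    ∃ B₀ B₇ C x₀ : ℝ, ∀ x : ℝ, x₀ ≤ x → ∀ M N Q R Q₁ : ℝ,
      M * N = x → x ^ ε ≤ N → N ≤ x ^ (1 - ε) →
      1 / 2 ≤ Q → 1 / 2 ≤ R → Q < Q₁ → Q₁ ≤ 2 * Q → Q * R < x / Real.log x ^ B₇ →
      x ^ ε * R < N → N < x ^ (-ε) * (x / R) ^ (1 / 3 : ℝ) →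
      ∀ β : ℕ → ℝ,
        (∀ N₁ N₂ : ℝ,
          SiegelWalfiszHyp N B Csw (fun n => if N₁ < (n : ℝ) ∧ (n : ℝ) ≤ N₂ then β n else 0)) →
        IsSifted (dyadic N) (Real.log x ^ B₀) β →
      ∀ α δ : ℕ → ℝ, (∀ r, |δ r| ≤ (σ 0 r : ℝ) ^ B) →
        |dispD a M N Q R α β (a7Weight Q₁) δ| ≤
          C * Real.sqrt (l2Sq M α) * Real.sqrt (l2Sq N β) * x ^ (1 / 2 : ℝ) / Real.log x ^ A := by
  intro a ha ε hε A hA B hB Csw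
  obtain ⟨B₀, B₇, C, x₀, hC⟩ := h a ha ε hε A hA B hB Csw
  refine ⟨B₀, B₇, C, max x₀ 0, fun x hx M N Q R Q₁ hMN hN1 hN2 hQ hR hQ1 hQ2 hQR hRN hNR β hsw
    hsift α δ hδ => ?_⟩
  have hx₀ : x₀ ≤ x := (le_max_left _ _).trans hx
  have hx0 : 0 ≤ x := (le_max_right _ _).trans hx
  have hN : 0 ≤ N := (Real.rpow_nonneg hx0 ε).trans hN1
  exact hC x hx₀ M N Q R Q₁ hMN hN1 hN2 hQ hR hQ1 hQ2 hQR hRN hNR β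
    (SiegelWalfiszHyp.of_interval hN hsw) hsift α δ hδ

end Literature.NumberTheory.Sieve
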